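import Literature.MathematicalPhysics.QuantumFieldTheory.Balaban1983to89.B14Claim247
import Literature.MathematicalPhysics.QuantumFieldTheory.Balaban1983to89.B8Eq115GaugeFixing

/-!
# `Balaban1983to89.B14Claim247Soft` — T. Bałaban, *Convergent renormalization expansions for lattice gauge theories*, Commun. Math. Phys. **119** (1988) 243–285 [Balaban1988Convergent]: the claim of p. 247, `|U U_{1,□′}⁻¹ − 1| < O(L²)ε₀` on `□′^{~2}`, in the PRINTED SOFT AXIAL GAUGE (`U_{1,□′}` axial, `U` only `ε₀`-axial — the `χ_Ax` of (1.5)–(1.6)), i.e. the soft-axial upgrade of `B14Claim247.Claim247Printed`, TYPED and PROVED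

statement-level skeleton of published theorems with citation tags; proofs where landed; nothing here is a claim about the Yang–Mills mass gap

PDF held: `paper:balaban1988-cmp119-convergent-renormalization` (journal page = PDF page + 242; p. 247 = PDF p. 5,
re-read for this file); `paper:balaban1985-cmp99-regular-spaces-gauge-fixing` (journal page = PDF page + 74;
Lemma 1 p. 79, (1.17) p. 78); `paper:balaban1985-cmp98-averaging` ((8) p. 18, p. 24, (45) p. 24);
`paper:balaban1987-cmp109-rg-i-small-field` ((0.11)–(0.16) pp. 253–254).

WHAT IS REPRODUCED.  SKELETON row `B14.Claim@247` (mega-formalization `lit-balaban`, HOME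
`run/shared/lean/pub/lit-balaban/`, PHASE2-TARGETS §G.3 seat **p26**, nominated by `lit-balaban-r11`): p. 247 *"A good
approximation on a cube □′ ⊂ B(P₁¹) is given by UU_{1,□′}⁻¹, where U_{1,□′} is taken in the axial gauge. It is
easy to see, by the same reasoning as in the proof of Lemma 1 [14], that |UU_{1,□′}⁻¹ − 1| < O(L²)ε₀ on □′^{~2}."*
The sibling `B14Claim247` (r11, p239956) typed it as `Claim247Printed` over the block-pair model `Hyp247` and proved
it with the declared deviation (D1) *the axial trees of `U` and `U₁` AGREE* (`U(Γ_{y,x}) = U₁(Γ_{y,x})`), whereas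
the print has `U₁ = U_{1,□′}` EXACTLY axial (`U₁(Γ_{y,x}) = 1`) and the integration variable `U` of (1.6) only
SOFTLY axial: `χ_Ax = ∏ χ({|U(y,x) − 1| < ε₀})`, `x ∈ B(y)`, `x ≠ y` ((1.5) p. 247).  THIS FILE REMOVES (D1):
* `HypSoft L U V₀ y κ a α₁ τ` — the hypotheses `B8Lemma1NonAbelian.Hyp` of the tree's Lemma 1 of [14] with the
  axial agreement RELAXED to `‖U(Γ_{z,x}) − V₀(Γ_{z,x})‖ ≤ τ`, `x ∈ B(z)`, `z ∈ {c₋, c₊}`; **`lemma1_soft`**: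
  `6ω ≤ 1 ⇒ ‖V′_b − 1‖ ≤ α₁ + ω(10 + 12α₁) + 2τ` on every bond of the pair (the tree's `lemma1_explicit` + `2τ`);
* `Hyp247Soft L U U₁ y κ ε₀` — the PRINTED hypotheses: as `Hyp247` but `U₁(Γ_{z,x}) = 1` ((1.15) of [14]) and
  `‖U(Γ_{z,x}) − 1‖ ≤ ε₀` (`χ_Ax`), so `τ = ε₀`; **`claim247_soft_explicit`**: `‖U_bU₁,b⁻¹ − 1‖ ≤
  10(d−1)(L−1)Lε₀ + 2ε₀` under `6(d−1)(L−1)Lε₀ ≤ 1`;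
* **`Claim247SoftPrinted d 𝔸`** (the printed form of `Claim247Printed` with `Hyp247Soft` for `Hyp247`) and
  **`Claim247SoftPrinted_holds`** — PROVED with the SAME constants `C = 10d + 1`, `c = 1/(6(d+1))`
  (`10(d−1)L²ε₀ + 2ε₀ ≤ (10d − 8)L²ε₀`); `hypSoft_of_hyp247`: the exact model is the case `τ = 0`.

THE PROOF ("one more triangle inequality per tree bond", organised as ONE gauge transformation).  Let
`g(x) := V₀(Γ_{z,x})⁻¹U(Γ_{z,x})`, `x ∈ B(z)`, `z ∈ {c₋, c₊} = {y, y + Le_κ}` (`straighten`; `g(c₋) = g(c₊) = 1`).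
(i) `Uᵍ` ((8) of [3]) has the axial trees of `V₀` (`Uᵍ(Γ_{z,x}) = g(z)U(Γ_{z,x})g(x)⁻¹ = V₀(Γ_{z,x})`), the same
plaquette deviations up to `U1`-conjugation and the SAME block average at `c` ((45) of [3] with trivial corner
values), so the tree's exact `lemma1_explicit` applies to `(Uᵍ, V₀)`; (ii) by (1.17) of [14],
`U_bV₀,b⁻¹ = g(b₋)⁻¹·[Uᵍ_bV₀,b⁻¹]·V₀,b g(b₊)V₀,b⁻¹`, whence `‖V′_b − 1‖ ≤ ‖g(b₋) − 1‖ + ‖Uᵍ_bV₀,b⁻¹ − 1‖ +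
‖g(b₊) − 1‖`, and `‖g(x) − 1‖ = ‖V₀(Γ)⁻¹(U(Γ) − V₀(Γ))‖ ≤ τ`.  Kernel-checked from `B7Prop1Explicit` (`hol_gaugeAct`,
`Wcx_gaugeAct`, `norm_units_conj_sub_one_le`), `B8Lemma1NonAbelian` (`lemma1_explicit`, `inBlock_iff`),
`B8Eq115GaugeFixing` (`axialFn_self`, `axialFn_gaugeAct`); no new carrier.

MODEL / HONEST SCOPE (referee F6/F7).  (D1′) The soft axial condition is typed on the tree contour variables
`U(Γ_{y,x})` of the `ℤ^d` carriers (`B7Prop1Explicit.axialFn`, B5 (1.7) trees) — p. 247 ll. 12–20 name exactly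
this gauge fixing "by the δ-functions of the contour variables U(Γ_{y,x}), as in [16] and in the previous papers …
it can be an alternative to the above definition"; the Euclidean-invariant AVERAGED contour variables
`U(y,x) = M({U(Γ)}_{Γ∈G(y,x)})` of (0.11) [I] used in (1.5) are not typed on these carriers (`lemma1_soft` takes
the discrepancy `τ` as a free parameter, so a later typing of `M` feeds it).  (D2), (D3) and the plaquette constant
`ε₀` for `U₁` (print: `ε₁L⁻²`, (1.4)) as in `B14Claim247`; `≤` where the print has `<` (formally stronger); block
averages of `U`, `U₁` agree exactly (`Ū = V`: `δ(ŪV⁻¹)` in (1.6) and the constraint of (1.2)).  Nothing printed is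
weakened into an assumption; net new unproved facts 0 (`Claim247SoftPrinted` is proved outright).  Unit
`lit-balaban-p26` (literature-prover-lit-balaban-p26-0).
-/

noncomputable section

open scoped BigOperators
open NormedSpace Finset

namespace Literature.MathematicalPhysics.QuantumFieldTheory.Balaban1983to89.B14Claim247Soft

open B7Prop1Explicit MatrixLog B8Lemma1NonAbelian
open B8Lemma1Lattice (InBlock)
open B8Eq115GaugeFixing (axialFn_self axialFn_gaugeAct)
open B14.Claim247 (Hyp247 ten_omegaC_le)

-- `Site` alone would resolve to the torus sites of `Setup.lean`: re-export the `ℤ^d` sites (as `B14Claim247`).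
export B7Prop1Explicit (Site)

variable {d : ℕ}

/-! ## §1 The straightening gauge transformation on a block pair `B(c₋) ∪ B(c₊)`, `c = ⟨y, y + Le_κ⟩` -/

section Algebra

variable {G : Type*} [Group G]

/-- The corner `z ∈ {c₋, c₊} = {y, y + Le_κ}` of the block of the pair `B(c₋) ∪ B(c₊)` to which `x` is referred:
`y` if `x_κ < y_κ + L`, else `y + Le_κ` (the two blocks (1.23) of a coarse bond differ only in the coordinate `κ`).
[cite: Balaban1985RegularSpaces, (1.23) p.79] -/
def basePt (L : ℕ) (y : Site d) (κ : Fin d) (x : Site d) : Site d :=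
  if x κ < y κ + L then y else y + (L : ℤ) • e κ

/-- `basePt` on `B(c₋) = B(y)`. [cite: Balaban1985RegularSpaces, (1.23) p.79] -/
theorem basePt_of_inBlock {L : ℕ} {y : Site d} (κ : Fin d) {x : Site d} (hx : InBlock L y x) :
    basePt L y κ x = y :=
  if_pos (hx κ).2

/-- `basePt` on `B(c₊) = B(y + Le_κ)`. [cite: Balaban1985RegularSpaces, (1.23) p.79] -/
theorem basePt_of_inBlock₁ {L : ℕ} {y : Site d} {κ : Fin d} {x : Site d}
    (hx : InBlock L (y + (L : ℤ) • e κ) x) : basePt L y κ x = y + (L : ℤ) • e κ := by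
  have h := (hx κ).1
  simp only [Pi.add_apply, zsmul_e_apply_self] at h
  exact if_neg (not_lt.mpr h)

/-- `basePt` at the corner `c₋ = y` (`L ≥ 1`). [cite: Balaban1985RegularSpaces, (1.23) p.79] -/
theorem basePt_self {L : ℕ} (hL : 1 ≤ L) (y : Site d) (κ : Fin d) : basePt L y κ y = y :=
  if_pos (by omega)

/-- `basePt` at the corner `c₊ = y + Le_κ`. [cite: Balaban1985RegularSpaces, (1.23) p.79] -/
theorem basePt_self₁ (L : ℕ) (y : Site d) (κ : Fin d) :
    basePt L y κ (y + (L : ℤ) • e κ) = y + (L : ℤ) • e κ := by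
  have h : ¬ ((y + (L : ℤ) • e κ) κ < y κ + L) := by
    simp only [Pi.add_apply, zsmul_e_apply_self]; omega
  exact if_neg h

/-- **The straightening gauge transformation** `g(x) := V₀(Γ_{z,x})⁻¹ · U(Γ_{z,x})`, `z = basePt x ∈ {c₋, c₊}`: the
quotient of the two axial-gauge transformations `v₀(x) = V(Γ_{z,x})` of [3] p. 24 (for `U` and for `V₀`) on each
block of the pair, `g(c₋) = g(c₊) = 1`; `Uᵍ` has the axial trees of `V₀`. [cite: Balaban1985Averaging, p.24] -/
def straighten (L : ℕ) (U V₀ : Site d → Fin d → G) (y : Site d) (κ : Fin d) : Site d → G :=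
  fun x => (axialFn V₀ (basePt L y κ x) x)⁻¹ * axialFn U (basePt L y κ x) x

/-- `straighten_apply` — unfolding. [cite: Balaban1985Averaging, p.24] -/
theorem straighten_apply (L : ℕ) (U V₀ : Site d → Fin d → G) (y : Site d) (κ : Fin d) (x : Site d) :
    straighten L U V₀ y κ x = (axialFn V₀ (basePt L y κ x) x)⁻¹ * axialFn U (basePt L y κ x) x := rfl

/-- `g(z) = 1` at the two corners `z = c₋, c₊` (the normalisation `u(y) = 1` of the block axial gauge,
(1.14) of [14]). [cite: Balaban1985RegularSpaces, (1.14) p.78] -/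
theorem straighten_eq_one {L : ℕ} (U V₀ : Site d → Fin d → G) {y : Site d} {κ : Fin d} {z : Site d}
    (hz : basePt L y κ z = z) : straighten L U V₀ y κ z = 1 := by
  rw [straighten_apply, hz, axialFn_self, axialFn_self, inv_one, one_mul]

/-- **`U^g` is axial relative to `V₀`**: `U^g(Γ_{z,x}) = g(z) U(Γ_{z,x}) g(x)⁻¹ = V₀(Γ_{z,x})` for `x` referred to
the corner `z` ((8) of [3] along the tree contour, `g(z) = 1`). [cite: Balaban1985Averaging, (8) p.18, p.24] -/
theorem axialFn_gaugeAct_straighten {L : ℕ} (U V₀ : Site d → Fin d → G) {y : Site d} {κ : Fin d}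
    {z x : Site d} (hz : basePt L y κ z = z) (hx : basePt L y κ x = z) :
    axialFn (gaugeAct (straighten L U V₀ y κ) U) z x = axialFn V₀ z x := by
  rw [axialFn_gaugeAct, straighten_eq_one U V₀ hz, straighten_apply, hx, one_mul, mul_inv_rev, inv_inv,
    mul_inv_cancel_left]

/-- **(1.17) of [14]** (`U′ᵍ(x, x′) = g(x)U′(x, x′)R(V₀(x, x′))g⁻¹(x′)`, `U′ = UV₀⁻¹`, `U′ᵍ = UᵍV₀⁻¹`), solved for
`U′`: `U_b V₀,b⁻¹ = g(b₋)⁻¹ · [Uᵍ_b V₀,b⁻¹] · V₀,b g(b₊) V₀,b⁻¹`. [cite: Balaban1985RegularSpaces, (1.17) p.78] -/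
theorem pert_eq_conj_gaugeAct (g : Site d → G) (U V₀ : Site d → Fin d → G) (x : Site d) (μ : Fin d) :
    pert U V₀ x μ = (g x)⁻¹ * (pert (gaugeAct g U) V₀ x μ * (V₀ x μ * g (x + e μ) * (V₀ x μ)⁻¹)) := by
  simp only [pert, gaugeAct]
  group

end Algebra

/-! ## §2 Normed estimates for the straightening -/

section Normed

variable {𝔸 : Type*} [NormedRing 𝔸] [NormOneClass 𝔸]

/-- The straightening is `U1`-valued for `U1`-valued fields. [cite: Balaban1985Averaging, p.24] -/
theorem straighten_mem {L : ℕ} {U V₀ : Site d → Fin d → 𝔸ˣ} (hU : ∀ x μ, U x μ ∈ U1 𝔸)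
    (hV₀ : ∀ x μ, V₀ x μ ∈ U1 𝔸) (y : Site d) (κ : Fin d) (x : Site d) : straighten L U V₀ y κ x ∈ U1 𝔸 :=
  (U1 𝔸).mul_mem ((U1 𝔸).inv_mem (axialFn_mem hV₀ _ _)) (axialFn_mem hU _ _)

/-- **`‖g(x) − 1‖ ≤ ‖U(Γ_{z,x}) − V₀(Γ_{z,x})‖`**, `z = basePt x` (`p⁻¹q − 1 = p⁻¹(q − p)`, `‖p⁻¹‖ ≤ 1`) — the one
extra triangle inequality per tree contour. [cite: Balaban1985Averaging, p.24] -/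
theorem norm_straighten_sub_one_le_norm_sub {L : ℕ} (U : Site d → Fin d → 𝔸ˣ) {V₀ : Site d → Fin d → 𝔸ˣ}
    (hV₀ : ∀ x μ, V₀ x μ ∈ U1 𝔸) (y : Site d) (κ : Fin d) (x : Site d) :
    ‖((straighten L U V₀ y κ x : 𝔸ˣ) : 𝔸) - 1‖
      ≤ ‖((axialFn U (basePt L y κ x) x : 𝔸ˣ) : 𝔸) - axialFn V₀ (basePt L y κ x) x‖ := by
  rw [straighten_apply, Units.val_mul, ← Units.inv_mul (axialFn V₀ (basePt L y κ x) x), ← mul_sub]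
  exact (norm_mul_le _ _).trans (mul_le_of_le_one_left (norm_nonneg _) (mem_U1.mp (axialFn_mem hV₀ _ _)).2)

/-- **Gauge invariance of (1.7)** on the plaquettes of a box: `V^g(∂p) = g(x)V(∂p)g(x)⁻¹` ((8) of [3] on a closed
contour) and `‖gPg⁻¹ − 1‖ ≤ ‖P − 1‖` for `g ∈ U1`. [cite: Balaban1985Averaging, (8) p.18] -/
theorem plaqSmall_gaugeAct {V : Site d → Fin d → 𝔸ˣ} {lo hi : Site d} {a : ℝ}
    (h : B8Lemma1NonAbelian.PlaqSmall V lo hi a) {g : Site d → 𝔸ˣ} (hg : ∀ x, g x ∈ U1 𝔸) :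
    B8Lemma1NonAbelian.PlaqSmall (gaugeAct g V) lo hi a := by
  intro x κ μ hκμ hlo hhi
  rw [hol_gaugeAct_closed _ _ _ _ (disp_plaqWord κ μ), Units.val_mul, Units.val_mul]
  exact (norm_units_conj_sub_one_le (hg x) _).trans (h x κ μ hκμ hlo hhi)

/-- **(1.17) of [14] in norm**: `‖U_b V₀,b⁻¹ − 1‖ ≤ ‖g(b₋) − 1‖ + ‖Uᵍ_b V₀,b⁻¹ − 1‖ + ‖g(b₊) − 1‖` for `U1`-valued
`U, V₀, g`. [cite: Balaban1985RegularSpaces, (1.17) p.78] -/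
theorem norm_pert_sub_one_le_of_gaugeAct {U V₀ : Site d → Fin d → 𝔸ˣ} (hU : ∀ x μ, U x μ ∈ U1 𝔸)
    (hV₀ : ∀ x μ, V₀ x μ ∈ U1 𝔸) {g : Site d → 𝔸ˣ} (hg : ∀ x, g x ∈ U1 𝔸) (x : Site d) (μ : Fin d) :
    ‖((pert U V₀ x μ : 𝔸ˣ) : 𝔸) - 1‖ ≤ ‖((g x : 𝔸ˣ) : 𝔸) - 1‖
      + ‖((pert (gaugeAct g U) V₀ x μ : 𝔸ˣ) : 𝔸) - 1‖ + ‖((g (x + e μ) : 𝔸ˣ) : 𝔸) - 1‖ := by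
  have hZ : pert (gaugeAct g U) V₀ x μ ∈ U1 𝔸 :=
    (U1 𝔸).mul_mem (gaugeAct_mem hU hg x μ) ((U1 𝔸).inv_mem (hV₀ x μ))
  rw [pert_eq_conj_gaugeAct g U V₀ x μ]
  calc _ ≤ ‖(((g x)⁻¹ : 𝔸ˣ) : 𝔸) - 1‖
        + ‖((pert (gaugeAct g U) V₀ x μ * (V₀ x μ * g (x + e μ) * (V₀ x μ)⁻¹) : 𝔸ˣ) : 𝔸) - 1‖ :=
        norm_units_mul_sub_one_le ((U1 𝔸).inv_mem (hg x))
    _ ≤ ‖((g x : 𝔸ˣ) : 𝔸) - 1‖ + (‖((pert (gaugeAct g U) V₀ x μ : 𝔸ˣ) : 𝔸) - 1‖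
        + ‖((V₀ x μ * g (x + e μ) * (V₀ x μ)⁻¹ : 𝔸ˣ) : 𝔸) - 1‖) :=
        add_le_add (norm_inv_sub_one_le (hg x)) (norm_units_mul_sub_one_le hZ)
    _ ≤ ‖((g x : 𝔸ˣ) : 𝔸) - 1‖ + (‖((pert (gaugeAct g U) V₀ x μ : 𝔸ˣ) : 𝔸) - 1‖
        + ‖((g (x + e μ) : 𝔸ˣ) : 𝔸) - 1‖) := by
        gcongr
        rw [Units.val_mul, Units.val_mul]
        exact norm_units_conj_sub_one_le (hV₀ x μ) _
    _ = _ := by ring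

end Normed

/-! ## §3 Lemma 1 of [14] with SOFT axial agreement -/

section SoftLemma1

variable {𝔸 : Type*} [NormedRing 𝔸] [NormOneClass 𝔸] [NormedAlgebra ℂ 𝔸] [CompleteSpace 𝔸]

omit [NormOneClass 𝔸] in
/-- **(45) of [3] with trivial corner values**: a gauge transformation with `g(c₋) = g(c₊) = 1` leaves the block
average (42) at `c` unchanged (`\bar{V^g}_c = g(c₋)V̄_c g(c₊)⁻¹`; here termwise: `W_{c,x}[V^g] = g(c₋)W_{c,x}g(c₋)⁻¹`
and `V^g(Γ_c) = g(c₋)V(Γ_c)g(c₊)⁻¹`, so no analyticity hypothesis is needed). [cite: Balaban1985Averaging, (45) p.24] -/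
theorem bavg_gaugeAct_of_eq_one (L : ℕ) {g : Site d → 𝔸ˣ} (V : Site d → Fin d → 𝔸ˣ)
    {y : Site d} {κ : Fin d} (hy : g y = 1) (hy₁ : g (y + (L : ℤ) • e κ) = 1) :
    bavg L (gaugeAct g V) y κ = bavg L V y κ := by
  have hX : Xavg L (gaugeAct g V) y κ = Xavg L V y κ := by
    unfold Xavg
    refine Finset.sum_congr rfl fun r _ => ?_
    rw [Wcx_gaugeAct, hy, one_mul, inv_one, mul_one]
  simp only [bavg, hX, hol_gaugeAct, disp_seg, hy, hy₁, one_mul, inv_one, mul_one]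

/-- **The hypotheses of Lemma 1 of [14] with SOFT axial agreement** on one coarse bond `c = ⟨y, y + Le_κ⟩`: as
`B8Lemma1NonAbelian.Hyp` (`U1 𝔸`-valued `U = V′V₀` and `V₀`; (1.7)`_{k=1}` `‖V(∂p) − 1‖ ≤ a` on the plaquettes of
`B(c₋) ∪ B(c₊)`; `‖Ū_c − V̄₀,c‖ ≤ α₁` for the averages (42) of [3]), but the axial condition (1.24)
`U(Γ_{z,x}) = V₀(Γ_{z,x})`, `x ∈ B(z)`, `z = c₋, c₊`, is relaxed to `‖U(Γ_{z,x}) − V₀(Γ_{z,x})‖ ≤ τ` (`τ = 0`: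
`Hyp`; `τ = ε₀`: `V₀` axial and `U` in the soft axial gauge `χ_Ax` of [Balaban1988Convergent] (1.5)–(1.6)).
[cite: Balaban1985RegularSpaces, (1.7) p.77, (1.24) p.79] -/
structure HypSoft (L : ℕ) (U V₀ : Site d → Fin d → 𝔸ˣ) (y : Site d) (κ : Fin d) (a α₁ τ : ℝ) : Prop where
  memU : ∀ x μ, U x μ ∈ U1 𝔸
  memV₀ : ∀ x μ, V₀ x μ ∈ U1 𝔸
  plaqU : B8Lemma1NonAbelian.PlaqSmall U y (y + pairTop L κ) a
  plaqV₀ : B8Lemma1NonAbelian.PlaqSmall V₀ y (y + pairTop L κ) a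
  axial : ∀ r : Fin d → Fin L,
    ‖((axialFn U y (y + boxVec L r) : 𝔸ˣ) : 𝔸) - axialFn V₀ y (y + boxVec L r)‖ ≤ τ
  axial₁ : ∀ r : Fin d → Fin L,
    ‖((axialFn U (y + (L : ℤ) • e κ) (y + (L : ℤ) • e κ + boxVec L r) : 𝔸ˣ) : 𝔸)
      - axialFn V₀ (y + (L : ℤ) • e κ) (y + (L : ℤ) • e κ + boxVec L r)‖ ≤ τ
  avg : ‖(bavg L U y κ : 𝔸) - bavg L V₀ y κ‖ ≤ α₁

/-- The exact hypotheses `Hyp` are the case `τ = 0`. [cite: Balaban1985RegularSpaces, (1.24) p.79] -/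
theorem HypSoft.of_hyp {L : ℕ} {U V₀ : Site d → Fin d → 𝔸ˣ} {y : Site d} {κ : Fin d} {a α₁ : ℝ}
    (H : Hyp L U V₀ y κ a α₁) : HypSoft L U V₀ y κ a α₁ 0 where
  memU := H.memU
  memV₀ := H.memV₀
  plaqU := H.plaqU
  plaqV₀ := H.plaqV₀
  axial r := by rw [H.axial r, sub_self, norm_zero]
  axial₁ r := by rw [H.axial₁ r, sub_self, norm_zero]
  avg := H.avg

/-- **Straightening turns `HypSoft` into the tree's exact `Hyp`** for `(U^g, V₀)`, with the same `a`, `α₁`.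
[cite: Balaban1985RegularSpaces, (1.24) p.79] -/
theorem HypSoft.hyp_straighten {L : ℕ} (hL : 1 ≤ L) {U V₀ : Site d → Fin d → 𝔸ˣ} {y : Site d} {κ : Fin d}
    {a α₁ τ : ℝ} (H : HypSoft L U V₀ y κ a α₁ τ) :
    Hyp L (gaugeAct (straighten L U V₀ y κ) U) V₀ y κ a α₁ where
  memU := gaugeAct_mem H.memU (straighten_mem H.memU H.memV₀ y κ)
  memV₀ := H.memV₀
  plaqU := plaqSmall_gaugeAct H.plaqU (straighten_mem H.memU H.memV₀ y κ)
  plaqV₀ := H.plaqV₀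
  axial r := axialFn_gaugeAct_straighten U V₀ (basePt_self hL y κ)
    (basePt_of_inBlock κ ((inBlock_iff L y _).mpr ⟨r, rfl⟩))
  axial₁ r := axialFn_gaugeAct_straighten U V₀ (basePt_self₁ L y κ)
    (basePt_of_inBlock₁ ((inBlock_iff L _ _).mpr ⟨r, rfl⟩))
  avg := by
    rw [bavg_gaugeAct_of_eq_one L U (straighten_eq_one U V₀ (basePt_self hL y κ))
      (straighten_eq_one U V₀ (basePt_self₁ L y κ))]
    exact H.avg

/-- On the sites of the pair the straightening is `τ`-close to `1`. [cite: Balaban1985RegularSpaces, (1.24) p.79] -/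
theorem HypSoft.norm_straighten_sub_one_le {L : ℕ} {U V₀ : Site d → Fin d → 𝔸ˣ} {y : Site d} {κ : Fin d}
    {a α₁ τ : ℝ} (H : HypSoft L U V₀ y κ a α₁ τ) {x : Site d} (hx : InPair L y κ x) :
    ‖((straighten L U V₀ y κ x : 𝔸ˣ) : 𝔸) - 1‖ ≤ τ := by
  refine (norm_straighten_sub_one_le_norm_sub U H.memV₀ y κ x).trans ?_
  rcases hx with hx | hx
  · rw [basePt_of_inBlock κ hx]
    obtain ⟨r, rfl⟩ := (inBlock_iff L y x).mp hx
    exact H.axial r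
  · rw [basePt_of_inBlock₁ hx]
    obtain ⟨r, rfl⟩ := (inBlock_iff L _ x).mp hx
    exact H.axial₁ r

/-- **Lemma 1 of [14], SOFT axial form, every bond of `B(c₋) ∪ B(c₊)`**: under `HypSoft` with `6ω ≤ 1`,
`ω = (d−1)(L−1)·L·a`, every bond `b` with both ends in the pair satisfies
`‖V′_b − 1‖ ≤ α₁ + ω(10 + 12α₁) + 2τ` — the tree's `lemma1_explicit` for `(U^g, V₀)` plus the two `τ`'s of
(1.17). [cite: Balaban1985RegularSpaces, Lemma 1 pp.79–80] -/
theorem lemma1_soft {L : ℕ} (hL : 1 ≤ L) {U V₀ : Site d → Fin d → 𝔸ˣ} {y : Site d} {κ : Fin d}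
    {a α₁ τ : ℝ} (H : HypSoft L U V₀ y κ a α₁ τ) (ha : 0 ≤ a) (hα₁ : 0 ≤ α₁) (hω : 6 * omegaC d L a ≤ 1)
    (x : Site d) (ν : Fin d) (hx : InPair L y κ x) (hxν : InPair L y κ (x + e ν)) :
    ‖((pert U V₀ x ν : 𝔸ˣ) : 𝔸) - 1‖ ≤ α₁ + omegaC d L a * (10 + 12 * α₁) + 2 * τ := by
  have hg : ∀ z, straighten L U V₀ y κ z ∈ U1 𝔸 := straighten_mem H.memU H.memV₀ y κ
  have hZ := lemma1_explicit hL (H.hyp_straighten hL) ha hα₁ hω x ν hx hxν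
  calc _ ≤ _ := norm_pert_sub_one_le_of_gaugeAct H.memU H.memV₀ hg x ν
    _ ≤ τ + (α₁ + omegaC d L a * (10 + 12 * α₁)) + τ :=
      add_le_add (add_le_add (H.norm_straighten_sub_one_le hx) hZ) (H.norm_straighten_sub_one_le hxν)
    _ = _ := by ring

end SoftLemma1

/-! ## §4 The p. 247 claim of [Balaban1988Convergent] in the printed soft axial gauge -/

section Model

variable {𝔸 : Type*} [NormedRing 𝔸] [NormOneClass 𝔸] [NormedAlgebra ℂ 𝔸] [CompleteSpace 𝔸]

/-- **The PRINTED hypotheses of the p. 247 claim on one block pair** `B(c₋) ∪ B(c₊)`, `c = ⟨y, y + Le_κ⟩`: as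
`B14Claim247.Hyp247` (`U`, `U₁ = U_{1,□′}(V)` are `U1 𝔸`-valued; plaquettes of both `ε₀`-close to `1` on the pair,
`χ₀` of (1.1) / (1.4); block-bond averages (42) agree, `Ū_c = Ū₁,c = V(c)`), but with the printed gauge
conditions in place of the model's axial agreement: `U₁` IS IN THE AXIAL GAUGE, `U₁(Γ_{z,x}) = 1` for `x ∈ B(z)`,
`z = c₋, c₊` (p. 247 "U_{1,□′} is taken in the axial gauge"; (1.15) of [14]), and `U` is in the SOFT axial gauge
`χ_Ax` of (1.5)–(1.6): `|U(Γ_{z,x}) − 1| < ε₀`, `x ∈ B(z)` (typed `≤`; on the tree contour variables, see (D1′)).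
[cite: Balaban1988Convergent, (1.5)–(1.6) p.247] -/
structure Hyp247Soft (L : ℕ) (U U₁ : Site d → Fin d → 𝔸ˣ) (y : Site d) (κ : Fin d) (ε₀ : ℝ) : Prop where
  memU : ∀ x μ, U x μ ∈ U1 𝔸
  memU₁ : ∀ x μ, U₁ x μ ∈ U1 𝔸
  plaqU : B8Lemma1NonAbelian.PlaqSmall U y (y + pairTop L κ) ε₀
  plaqU₁ : B8Lemma1NonAbelian.PlaqSmall U₁ y (y + pairTop L κ) ε₀
  softAxial : ∀ r : Fin d → Fin L, ‖((axialFn U y (y + boxVec L r) : 𝔸ˣ) : 𝔸) - 1‖ ≤ ε₀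
  softAxial₁ : ∀ r : Fin d → Fin L,
    ‖((axialFn U (y + (L : ℤ) • e κ) (y + (L : ℤ) • e κ + boxVec L r) : 𝔸ˣ) : 𝔸) - 1‖ ≤ ε₀
  axial : ∀ r : Fin d → Fin L, axialFn U₁ y (y + boxVec L r) = 1
  axial₁ : ∀ r : Fin d → Fin L, axialFn U₁ (y + (L : ℤ) • e κ) (y + (L : ℤ) • e κ + boxVec L r) = 1
  avg : bavg L U y κ = bavg L U₁ y κ

/-- `Hyp247Soft` is `HypSoft` with `a = ε₀`, `α₁ = 0`, `τ = ε₀` (`‖U(Γ) − U₁(Γ)‖ = ‖U(Γ) − 1‖ ≤ ε₀`).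
[cite: Balaban1988Convergent, p.247] -/
theorem Hyp247Soft.toHypSoft {L : ℕ} {U U₁ : Site d → Fin d → 𝔸ˣ} {y : Site d} {κ : Fin d} {ε₀ : ℝ}
    (H : Hyp247Soft L U U₁ y κ ε₀) : HypSoft L U U₁ y κ ε₀ 0 ε₀ where
  memU := H.memU
  memV₀ := H.memU₁
  plaqU := H.plaqU
  plaqV₀ := H.plaqU₁
  axial r := by rw [H.axial r, Units.val_one]; exact H.softAxial r
  axial₁ r := by rw [H.axial₁ r, Units.val_one]; exact H.softAxial₁ r
  avg := by rw [H.avg, sub_self, norm_zero]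

/-- The exact-axial model `Hyp247` of `B14Claim247` is `HypSoft` with `τ = 0`.
[cite: Balaban1988Convergent, p.247] -/
theorem hypSoft_of_hyp247 {L : ℕ} {U U₁ : Site d → Fin d → 𝔸ˣ} {y : Site d} {κ : Fin d} {ε₀ : ℝ}
    (H : Hyp247 L U U₁ y κ ε₀) : HypSoft L U U₁ y κ ε₀ 0 0 :=
  HypSoft.of_hyp H.toHyp

/-- **p. 247, soft axial gauge, explicit form** ("by the same reasoning as in the proof of Lemma 1 [14]"): under
`Hyp247Soft` and the smallness `6(d−1)(L−1)Lε₀ ≤ 1`, every bond `b = ⟨x, x + e_ν⟩` of the block pair satisfies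
`‖U_b U₁,b⁻¹ − 1‖ ≤ 10·(d−1)(L−1)L·ε₀ + 2ε₀` (the exact-axial bound of `B14Claim247.claim247_explicit` plus one
`ε₀` per end of `b`). [cite: Balaban1988Convergent, p.247] -/
theorem claim247_soft_explicit {L : ℕ} (hL : 1 ≤ L) {U U₁ : Site d → Fin d → 𝔸ˣ} {y : Site d} {κ : Fin d}
    {ε₀ : ℝ} (H : Hyp247Soft L U U₁ y κ ε₀) (hε₀ : 0 ≤ ε₀) (hω : 6 * omegaC d L ε₀ ≤ 1) (x : Site d)
    (ν : Fin d) (hx : InPair L y κ x) (hxν : InPair L y κ (x + e ν)) :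
    ‖((pert U U₁ x ν : 𝔸ˣ) : 𝔸) - 1‖ ≤ 10 * omegaC d L ε₀ + 2 * ε₀ := by
  have h := lemma1_soft hL H.toHypSoft hε₀ le_rfl hω x ν hx hxν
  have h' : (0 : ℝ) + omegaC d L ε₀ * (10 + 12 * 0) + 2 * ε₀ = 10 * omegaC d L ε₀ + 2 * ε₀ := by ring
  rwa [h'] at h

end Model

section Printed

/-- **B14 p. 247 (verbatim): *"A good approximation on a cube □′ ⊂ B(P₁¹) is given by UU_{1,□′}⁻¹, where
U_{1,□′} is taken in the axial gauge. It is easy to see, by the same reasoning as in the proof of Lemma 1 [14], that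
|UU_{1,□′}⁻¹ − 1| < O(L²)ε₀ on □′^{~2}."*** — typed in printed form over the block-pair model with the PRINTED gauge
conditions (`Hyp247Soft`: `U_{1,□′}` axial, `U` in the soft axial gauge `χ_Ax` of (1.5)–(1.6); deviations (D1′),
(D2), (D3) of the module docstring): there are constants `C, c > 0` such that for every block side `L ≥ 1`, every
`ε₀ > 0` with `L²ε₀ ≤ c`, every pair `(U, U₁)` satisfying the hypotheses on a block pair and every bond `b` of that
pair, `|U_b U₁,b⁻¹ − 1| < C·L²·ε₀`. [cite: Balaban1988Convergent, p.247] -/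
def Claim247SoftPrinted (d : ℕ) (𝔸 : Type*) [NormedRing 𝔸] [NormOneClass 𝔸] [NormedAlgebra ℂ 𝔸]
    [CompleteSpace 𝔸] : Prop :=
  ∃ C c : ℝ, 0 < C ∧ 0 < c ∧ ∀ L : ℕ, 1 ≤ L → ∀ ε₀ : ℝ, 0 < ε₀ → (L : ℝ) ^ 2 * ε₀ ≤ c →
    ∀ (U U₁ : Site d → Fin d → 𝔸ˣ) (y : Site d) (κ : Fin d), Hyp247Soft L U U₁ y κ ε₀ →
      ∀ (x : Site d) (ν : Fin d), InPair L y κ x → InPair L y κ (x + e ν) →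
        ‖((pert U U₁ x ν : 𝔸ˣ) : 𝔸) - 1‖ < C * (L : ℝ) ^ 2 * ε₀

/-- **`Claim247SoftPrinted` HOLDS**, with the same constants `C = 10d + 1`, `c = 1/(6(d+1))` as the exact-axial
`B14Claim247.Claim247Printed_holds`: `10(d−1)(L−1)Lε₀ + 2ε₀ ≤ (10d − 8)L²ε₀ < (10d + 1)L²ε₀`.
[cite: Balaban1988Convergent, p.247] -/
theorem Claim247SoftPrinted_holds (d : ℕ) (𝔸 : Type*) [NormedRing 𝔸] [NormOneClass 𝔸] [NormedAlgebra ℂ 𝔸]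
    [CompleteSpace 𝔸] : Claim247SoftPrinted d 𝔸 := by
  refine ⟨10 * (d : ℝ) + 1, 1 / (6 * ((d : ℝ) + 1)), by positivity, by positivity, ?_⟩
  intro L hL ε₀ hε₀ hsmall U U₁ y κ H x ν hx hxν
  rcases Nat.eq_zero_or_pos d with hd0 | hd
  · subst hd0; exact Fin.elim0 κ
  have h1 : (1 : ℝ) ≤ L := by exact_mod_cast hL
  have h2 : (1 : ℝ) ≤ d := by exact_mod_cast hd
  have hd1 : (0 : ℝ) ≤ (d : ℝ) - 1 := by linarith
  -- `10ω ≤ 10(d − 1)·L²ε₀`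
  have h10 := ten_omegaC_le (L := L) hd hε₀.le
  have hω : omegaC d L ε₀ ≤ ((d : ℝ) - 1) * ((L : ℝ) ^ 2 * ε₀) := by nlinarith
  -- smallness: `6ω ≤ 6(d−1)L²ε₀ ≤ 6(d−1)c = (d−1)/(d+1) ≤ 1`
  have hω1 : 6 * omegaC d L ε₀ ≤ 1 := by
    have hc : ((d : ℝ) - 1) * ((L : ℝ) ^ 2 * ε₀) ≤ ((d : ℝ) - 1) * (1 / (6 * ((d : ℝ) + 1))) :=
      mul_le_mul_of_nonneg_left hsmall hd1
    have hq : 6 * (((d : ℝ) - 1) * (1 / (6 * ((d : ℝ) + 1)))) ≤ 1 := by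
      rw [show 6 * (((d : ℝ) - 1) * (1 / (6 * ((d : ℝ) + 1)))) = ((d : ℝ) - 1) / ((d : ℝ) + 1) by
        field_simp]
      rw [div_le_one (by linarith)]
      linarith
    linarith
  have hb := claim247_soft_explicit hL H hε₀.le hω1 x ν hx hxν
  -- `2ε₀ ≤ 2L²ε₀` and `10ω + 2ε₀ ≤ (10d − 8)L²ε₀ < (10d + 1)L²ε₀`
  have hL1 : (1 : ℝ) ≤ (L : ℝ) ^ 2 := by nlinarith
  have h2ε : ε₀ ≤ (L : ℝ) ^ 2 * ε₀ := le_mul_of_one_le_left hε₀.le hL1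
  have hlt : 10 * omegaC d L ε₀ + 2 * ε₀ < (10 * (d : ℝ) + 1) * (L : ℝ) ^ 2 * ε₀ := by
    have hpos : 0 < (L : ℝ) ^ 2 * ε₀ := by positivity
    nlinarith
  exact lt_of_le_of_lt hb hlt

end Printed

end Literature.MathematicalPhysics.QuantumFieldTheory.Balaban1983to89.B14Claim247Soft
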